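import Summits.QuantumFields.BalabanUV.Beta.FP.TowerK2bDefectClosed
import Summits.QuantumFields.BalabanUV.Beta.FP.TowerK2bDefectStoreySum

/-!
# `BalabanUV.Beta.FP.TowerK2bDefectStoreySumClosed` — road «FP», binder row D1, ROUTE T (β1): **THE END WRAPPER's WARD DEFECT IN SOLVED FORM, LETTER-FREE** —
# `TowerK2bDefectClosed.defect_eq_sum_smul_R` (p625806: `Def(λ; ρ′,w) = Σ_s λ s • R m ρ′ w s` for ANY remainder letter `R` carrying the recursion pins `hR0 ∕ hRsucc`) composed
# with `TowerK2bDefectStoreySum.sum_smul_R_eq_storeySum` (g50: `Σ_s λ s • R m ρ′ w s =` the `compLinKer`-weighted sum of every storey's door gap) at the ONE `R` the pins define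
# (§1: the recursion HAS a solution — `Nat.rec` on the depth, both pins by `rfl`; no `def`): for every depth `m+2`, every coarse period `M′` (`M = Lc^(m+2)·M′`), coarse bond
# `(ρ′,w)`, an2's even composite mixed family `V` (pinned by `hV` exactly as in `def_allDepths`) and every torus gauge function `λ`,
# `Σ_b (Dλ)_b • ℳ̂₂ᵉ(b)|ff − (−wM2) • [E_λ, Ĉ⁽ᵐ⁺²⁾_{ρ′,w}] = Σ_{(j,k): j+k=m} Σ_κ Σ_{y ∈ winF (Lc^j) (wid Lc j) w} compLinKer ℓ̃ Lc j (κ,y) (ρ′,w) • (wM2 • [E_λ, L̂_kᵀH_{κ,y}L̂_k] − wM2 • L̂_kᵀ[E_{rt,k}, H_{κ,y}]L̂_k)`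
# — NO displayed letter: v8∕v9's `Def(λ; β)` at box `n = m` IS the composite-linear-weighted sum of the door gaps of every storey (SPEC-63 (T2)'s right side ∕ SPEC-64 §3 (b′)'s
# theorem side ∕ an2 J-NOTE-17 §7 ∕ packet R-AN2-73-1 §5 (b)), over the record's own objects (`tgrad`, `perF ∕ dper`, `M2Of … (compMix …)`, `compH`, `compLinKer`, `symHessKerAt`,
# `symLinKerAt`, `winF ∕ wid ∕ offs`) and nothing else

WHY.  `def_allDepths` displays `R` by pins so that each lineage could contract it in its own presentation; with the recursion SOLVED (`StoreySum`) the letter is discharged: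
§1 exhibits the pinned family by primitive recursion on the depth (the pins hold definitionally), §2 is the composition.  Consumers (the row's ONE file for SPEC-64 (ii-A)'s
door family `𝒲Δ`; Engine C's G_sc in-job check (R-AN2-74-GSC); the referee) read ONE identity with no hypothesis beyond the period factorisation `hM` and the family pin `hV`.
[folklore] composition BY NAME; no `def`, no `def … : Prop`, nothing cited, 0 sorry.  No claim that any door gap, weighted sum of door gaps or door tadpole vanishes (by value
the top gap does NOT at n = 0: Engine C K2L ×3, zero weight); (J-R₂″) ∕ `hDΔ` NOT claimed either way; nothing typed on the order-2 H-side rows, no law file (ROAD POLICY g49∕g50;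
SPEC-64 is a SPEC).  Nothing of Bałaban's asserted, valued or discharged; 0 estimates; 0∕4 row-D1 binders (hW, hR, D1Tel, D1Rep); ROOT M‴ p325680 ∕ P5c ∕ D6 untouched;
(L2′) NOT discharged; NOT (C1), NOT (T-ID), NOT D1, NEVER «G-an2-4 closed», NOT BetaPertH, NOT continuum, NOT Clay.

HONEST DEPENDENCY (page 1, mandatory): continuum YM on T⁴ ⇐ BetaPertH ∧ nine spine estimates (0/9 proved); BetaPertH ⇐ (D1) ∧ (D4) ∧ CAP+tail;
G-an2-4 gates asym, D1 and NE2/3/4.  HONEST FRAMING (cell contract, verbatim): «discharging `BetaPertH` makes Bałaban's UV stability UNCONDITIONAL —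
a real constructive-QFT result; it is NOT the continuum limit and NOT the Clay problem.»  ABSOLUTE RULE (cell charter, verbatim): «No internally-minted
statement may enter as a cited fact. Every hypothesis is either kernel-proved in this package or a verbatim quotation of a PUBLISHED theorem with page
reference. The manuscript(s) under audit are NOT citable for their own disputed steps — they are the thing under adjudication; programme-internal
(2001/route/tribunal) claims are never citable.»  Road «FP» OWNER, b2b-balaban-beta-d1-p3 gen 50, 2026-08-28.  No existing file touched.
-/

noncomputable section

open scoped BigOperators

namespace Summit.QuantumFields.BalabanUV.Beta.FP.TowerK2bDefectStoreySumClosed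

open Finset Matrix
open Literature.MathematicalPhysics.QuantumFieldTheory
open Literature.MathematicalPhysics.QuantumFieldTheory.Balaban1983to89
open Literature.MathematicalPhysics.QuantumFieldTheory.Balaban1983to89.Beta
open B4TorusKernel.MultiPeriod (translate)
open B6Lemma24Torus (pbox)
open ExpKernelCalculus (MKer)
open AffineAveraging (Site)
open AveragingContoursRooted (ctr ctrOff)
open OneStepResolventKernel (Fib)
open BalabanStepW2 (M2Of wM2)
open Summit.QuantumFields.BalabanUV.Beta.TameKernelCalculus (trK)
open Summit.QuantumFields.BalabanUV.Beta.BorderedHessian (sgnK)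
open Summit.QuantumFields.BalabanUV.Beta.SymAveragingHessianCounts (symLinKerAt symHessKerAt)
open Summit.QuantumFields.BalabanUV.Beta.CompositeVertexKernelRec (offs winF wid compLinKer)
open Summit.QuantumFields.BalabanUV.Beta.CompositeOneShotJets (compMix compH)
open Summit.QuantumFields.BalabanUV.Beta.FP.KernelPeriodisationFib (Idx perF)
open Summit.QuantumFields.BalabanUV.Beta.FP.KernelPeriodisationFibLoc (dper)
open Summit.QuantumFields.BalabanUV.Beta.FP.TorusGaugeCovariance (tgrad)
open Summit.QuantumFields.BalabanUV.Beta.FP.TorusGaugeCovariancePairing (wrapPt)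
open Summit.QuantumFields.BalabanUV.Beta.FP.TowerK2bDefectClosed (defect_eq_sum_smul_R)
open Summit.QuantumFields.BalabanUV.Beta.FP.TowerK2bDefectStoreySum (sum_smul_R_eq_storeySum)

variable {Lc : ℕ} [NeZero Lc] {M : Fin (3 + 1) → ℕ} [∀ μ, NeZero (M μ)] (L₂ j : ℕ)

/-! ## §1 The recursion pins have a solution (primitive recursion on the depth; both pins definitional) -/

omit [NeZero Lc] in
/-- [folklore] **`exists_R_pins`**: there IS a site-remainder family `R` with `def_allDepths`' two pins (the depth-`0` transport-variation word; the top D-words plus the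
window-weighted family one depth down) — the one defined by primitive recursion on the depth (`Nat.rec`; both pins hold by `rfl`).  No `def` is introduced. -/
theorem exists_R_pins :
    ∃ R : ℕ → Fin (3 + 1) → Site (3 + 1) → ↥(pbox M) → Matrix (↥(pbox M) × Fin (3 + 1)) (↥(pbox M) × Fin (3 + 1)) ℝ,
      (∀ (ρ' : Fin (3 + 1)) (w : Site (3 + 1)) (s : ↥(pbox M)), R 0 ρ' w s
      = wM2 3 L₂ j • ∑ κ₁ : Fin (3 + 1), ∑ e₁ ∈ offs Lc, ∑ κ₂ : Fin (3 + 1), ∑ e₂ ∈ offs Lc,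
            symHessKerAt (ctr 4 Lc) Lc ρ' w (κ₁, (Lc : ℤ) • w + e₁) (κ₂, (Lc : ℤ) • w + e₂) •
              (Matrix.vecMulVec
                  (fun x : ↥(pbox M) × Fin (3 + 1) => ((if x.1 = s then (1 : ℝ) else 0) - (if wrapPt M ((Lc : ℤ) • ((Lc : ℤ) • w + e₁) + ctr 4 Lc) = s then (1 : ℝ) else 0))
                    * ∑' n : Site (3 + 1), symLinKerAt (ctr 4 Lc) Lc κ₁ ((Lc : ℤ) • w + e₁) (x.2, translate M (x.1 : Site (3 + 1)) n))
                  (fun z : ↥(pbox M) × Fin (3 + 1) => ∑' n : Site (3 + 1), symLinKerAt (ctr 4 Lc) Lc κ₂ ((Lc : ℤ) • w + e₂) (z.2, translate M (z.1 : Site (3 + 1)) n))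
                - Matrix.vecMulVec
                  (fun x : ↥(pbox M) × Fin (3 + 1) => ∑' n : Site (3 + 1), symLinKerAt (ctr 4 Lc) Lc κ₁ ((Lc : ℤ) • w + e₁) (x.2, translate M (x.1 : Site (3 + 1)) n))
                  (fun z : ↥(pbox M) × Fin (3 + 1) => ((if z.1 = s then (1 : ℝ) else 0) - (if wrapPt M ((Lc : ℤ) • ((Lc : ℤ) • w + e₂) + ctr 4 Lc) = s then (1 : ℝ) else 0))
                    * ∑' n : Site (3 + 1), symLinKerAt (ctr 4 Lc) Lc κ₂ ((Lc : ℤ) • w + e₂) (z.2, translate M (z.1 : Site (3 + 1)) n))))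
      ∧ (∀ (m : ℕ) (ρ' : Fin (3 + 1)) (w : Site (3 + 1)) (s : ↥(pbox M)), R (m + 1) ρ' w s
      = wM2 3 L₂ j • (∑ κ₁ : Fin (3 + 1), ∑ e₁ ∈ offs Lc, ∑ κ₂ : Fin (3 + 1), ∑ e₂ ∈ offs Lc,
            symHessKerAt (ctr 4 Lc) Lc ρ' w (κ₁, (Lc : ℤ) • w + e₁) (κ₂, (Lc : ℤ) • w + e₂) •
              (Matrix.vecMulVec
                  (fun x : ↥(pbox M) × Fin (3 + 1) => ((if x.1 = s then (1 : ℝ) else 0)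
                      - (if wrapPt M (((Lc ^ (m + 1 + 1) : ℕ) : ℤ) • ((Lc : ℤ) • w + e₁) + ∑ k ∈ Finset.range (m + 1 + 1), ((Lc ^ k : ℕ) : ℤ) • ctr 4 Lc) = s then (1 : ℝ) else 0))
                    * ∑' n : Site (3 + 1), compLinKer (fun _ => symLinKerAt (ctr 4 Lc) Lc) Lc (m + 1 + 1) (x.2, translate M (x.1 : Site (3 + 1)) n) (κ₁, (Lc : ℤ) • w + e₁))
                  (fun z : ↥(pbox M) × Fin (3 + 1) => ∑' n : Site (3 + 1),
                    compLinKer (fun _ => symLinKerAt (ctr 4 Lc) Lc) Lc (m + 1 + 1) (z.2, translate M (z.1 : Site (3 + 1)) n) (κ₂, (Lc : ℤ) • w + e₂))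
                - Matrix.vecMulVec
                  (fun x : ↥(pbox M) × Fin (3 + 1) => ∑' n : Site (3 + 1),
                    compLinKer (fun _ => symLinKerAt (ctr 4 Lc) Lc) Lc (m + 1 + 1) (x.2, translate M (x.1 : Site (3 + 1)) n) (κ₁, (Lc : ℤ) • w + e₁))
                  (fun z : ↥(pbox M) × Fin (3 + 1) => ((if z.1 = s then (1 : ℝ) else 0)
                      - (if wrapPt M (((Lc ^ (m + 1 + 1) : ℕ) : ℤ) • ((Lc : ℤ) • w + e₂) + ∑ k ∈ Finset.range (m + 1 + 1), ((Lc ^ k : ℕ) : ℤ) • ctr 4 Lc) = s then (1 : ℝ) else 0))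
                    * ∑' n : Site (3 + 1), compLinKer (fun _ => symLinKerAt (ctr 4 Lc) Lc) Lc (m + 1 + 1) (z.2, translate M (z.1 : Site (3 + 1)) n) (κ₂, (Lc : ℤ) • w + e₂))))
        + ∑ κ : Fin (3 + 1), ∑ e ∈ offs Lc, symLinKerAt (ctr 4 Lc) Lc ρ' w (κ, (Lc : ℤ) • w + e) • R m κ ((Lc : ℤ) • w + e) s) :=
  ⟨fun m => Nat.rec (motive := fun _ => Fin (3 + 1) → Site (3 + 1) → ↥(pbox M) → Matrix (↥(pbox M) × Fin (3 + 1)) (↥(pbox M) × Fin (3 + 1)) ℝ)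
      (fun ρ' w s => wM2 3 L₂ j • ∑ κ₁ : Fin (3 + 1), ∑ e₁ ∈ offs Lc, ∑ κ₂ : Fin (3 + 1), ∑ e₂ ∈ offs Lc,
            symHessKerAt (ctr 4 Lc) Lc ρ' w (κ₁, (Lc : ℤ) • w + e₁) (κ₂, (Lc : ℤ) • w + e₂) •
              (Matrix.vecMulVec
                  (fun x : ↥(pbox M) × Fin (3 + 1) => ((if x.1 = s then (1 : ℝ) else 0) - (if wrapPt M ((Lc : ℤ) • ((Lc : ℤ) • w + e₁) + ctr 4 Lc) = s then (1 : ℝ) else 0))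
                    * ∑' n : Site (3 + 1), symLinKerAt (ctr 4 Lc) Lc κ₁ ((Lc : ℤ) • w + e₁) (x.2, translate M (x.1 : Site (3 + 1)) n))
                  (fun z : ↥(pbox M) × Fin (3 + 1) => ∑' n : Site (3 + 1), symLinKerAt (ctr 4 Lc) Lc κ₂ ((Lc : ℤ) • w + e₂) (z.2, translate M (z.1 : Site (3 + 1)) n))
                - Matrix.vecMulVec
                  (fun x : ↥(pbox M) × Fin (3 + 1) => ∑' n : Site (3 + 1), symLinKerAt (ctr 4 Lc) Lc κ₁ ((Lc : ℤ) • w + e₁) (x.2, translate M (x.1 : Site (3 + 1)) n))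
                  (fun z : ↥(pbox M) × Fin (3 + 1) => ((if z.1 = s then (1 : ℝ) else 0) - (if wrapPt M ((Lc : ℤ) • ((Lc : ℤ) • w + e₂) + ctr 4 Lc) = s then (1 : ℝ) else 0))
                    * ∑' n : Site (3 + 1), symLinKerAt (ctr 4 Lc) Lc κ₂ ((Lc : ℤ) • w + e₂) (z.2, translate M (z.1 : Site (3 + 1)) n))))
      (fun m Rm ρ' w s => wM2 3 L₂ j • (∑ κ₁ : Fin (3 + 1), ∑ e₁ ∈ offs Lc, ∑ κ₂ : Fin (3 + 1), ∑ e₂ ∈ offs Lc,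
            symHessKerAt (ctr 4 Lc) Lc ρ' w (κ₁, (Lc : ℤ) • w + e₁) (κ₂, (Lc : ℤ) • w + e₂) •
              (Matrix.vecMulVec
                  (fun x : ↥(pbox M) × Fin (3 + 1) => ((if x.1 = s then (1 : ℝ) else 0)
                      - (if wrapPt M (((Lc ^ (m + 1 + 1) : ℕ) : ℤ) • ((Lc : ℤ) • w + e₁) + ∑ k ∈ Finset.range (m + 1 + 1), ((Lc ^ k : ℕ) : ℤ) • ctr 4 Lc) = s then (1 : ℝ) else 0))
                    * ∑' n : Site (3 + 1), compLinKer (fun _ => symLinKerAt (ctr 4 Lc) Lc) Lc (m + 1 + 1) (x.2, translate M (x.1 : Site (3 + 1)) n) (κ₁, (Lc : ℤ) • w + e₁))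
                  (fun z : ↥(pbox M) × Fin (3 + 1) => ∑' n : Site (3 + 1),
                    compLinKer (fun _ => symLinKerAt (ctr 4 Lc) Lc) Lc (m + 1 + 1) (z.2, translate M (z.1 : Site (3 + 1)) n) (κ₂, (Lc : ℤ) • w + e₂))
                - Matrix.vecMulVec
                  (fun x : ↥(pbox M) × Fin (3 + 1) => ∑' n : Site (3 + 1),
                    compLinKer (fun _ => symLinKerAt (ctr 4 Lc) Lc) Lc (m + 1 + 1) (x.2, translate M (x.1 : Site (3 + 1)) n) (κ₁, (Lc : ℤ) • w + e₁))
                  (fun z : ↥(pbox M) × Fin (3 + 1) => ((if z.1 = s then (1 : ℝ) else 0)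
                      - (if wrapPt M (((Lc ^ (m + 1 + 1) : ℕ) : ℤ) • ((Lc : ℤ) • w + e₂) + ∑ k ∈ Finset.range (m + 1 + 1), ((Lc ^ k : ℕ) : ℤ) • ctr 4 Lc) = s then (1 : ℝ) else 0))
                    * ∑' n : Site (3 + 1), compLinKer (fun _ => symLinKerAt (ctr 4 Lc) Lc) Lc (m + 1 + 1) (z.2, translate M (z.1 : Site (3 + 1)) n) (κ₂, (Lc : ℤ) • w + e₂))))
        + ∑ κ : Fin (3 + 1), ∑ e ∈ offs Lc, symLinKerAt (ctr 4 Lc) Lc ρ' w (κ, (Lc : ℤ) • w + e) • Rm κ ((Lc : ℤ) • w + e) s) m,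
    fun _ _ _ => rfl, fun _ _ _ _ => rfl⟩

/-! ## §2 The END wrapper's Ward defect in solved form, letter-free -/

/-- [folklore] **`defect_eq_storeySum` — THE END WRAPPER's WARD DEFECT IS THE COMPOSITE-LINEAR-WEIGHTED SUM OF THE DOOR GAPS OF EVERY STOREY, WITH NO DISPLAYED LETTER.**
At every depth `m+2` (`M = Lc^(m+2)·M′`), for an2's even composite mixed family `V` (pin `hV`, as in `def_allDepths`) and every torus gauge function `λ`:
`Σ_b (Dλ)_b • ℳ̂₂ᵉ(b)|ff − (−wM2) • (E_λ·Ĉ − Ĉ·E_λ) = Σ_{p ∈ antidiagonal m} Σ_κ Σ_{y ∈ winF (Lc^p.1) (wid Lc p.1) w} compLinKer ℓ̃ Lc p.1 (κ,y) (ρ′,w) • (wM2 • (E_λ·L̂ᵀHL̂ − L̂ᵀHL̂·E_λ) − wM2 • L̂ᵀ·(E_rt·H − H·E_rt)·L̂)`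
(storey-`p.2` legs `L̂`, brick `H`, roots `E_rt` at the storey bond `(κ,y)` exactly as in `TowerK2bDefectStoreySum.sum_smul_R_eq_storeySum`) —
`TowerK2bDefectClosed.defect_eq_sum_smul_R` ⨾ `TowerK2bDefectStoreySum.sum_smul_R_eq_storeySum` at §1's `R`. -/
theorem defect_eq_storeySum
    (m : ℕ) (M' : Fin (3 + 1) → ℕ) [∀ μ, NeZero (M' μ)] (hM : ∀ i, M i = Lc ^ (m + 1 + 1) * M' i)
    (ρ' : Fin (3 + 1)) (w : Site (3 + 1)) (V : Fin (3 + 1) → Site (3 + 1) → MKer (3 + 1) (Fib 3))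
    (hV : V = fun κ u x z a c => ∑' n : Site (3 + 1),
      ((1 / 2 : ℝ) • (M2Of 3 L₂ (compMix (ctrOff (3 + 1) Lc) Lc (m + 1 + 1)) j κ u ρ' (translate M' w n)
          + sgnK (trK (M2Of 3 L₂ (compMix (ctrOff (3 + 1) Lc) Lc (m + 1 + 1)) j κ u ρ' (translate M' w n))))) x z a c)
    (lam : ↥(pbox M) → ℝ) :
    (∑ b : ↥(pbox M) × Fin (3 + 1), (∑ s : ↥(pbox M), tgrad M (b.1, Sum.inl b.2) s * lam s) •
        (perF M (dper M (V b.2 (b.1 : Site (3 + 1))))).submatrix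
          (fun b : ↥(pbox M) × Fin (3 + 1) => ((b.1, Sum.inl b.2) : Idx M (Fib 3)))
          (fun b : ↥(pbox M) × Fin (3 + 1) => ((b.1, Sum.inl b.2) : Idx M (Fib 3))))
        - (-(wM2 3 L₂ j)) • (Matrix.diagonal (fun b : ↥(pbox M) × Fin (3 + 1) => lam b.1)
            * (perF M (dper M (compH (ctrOff (3 + 1) Lc) Lc (m + 1 + 1) ρ' w))).submatrix
                (fun b : ↥(pbox M) × Fin (3 + 1) => ((b.1, Sum.inl b.2) : Idx M (Fib 3)))
                (fun b : ↥(pbox M) × Fin (3 + 1) => ((b.1, Sum.inl b.2) : Idx M (Fib 3)))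
          - (perF M (dper M (compH (ctrOff (3 + 1) Lc) Lc (m + 1 + 1) ρ' w))).submatrix
                (fun b : ↥(pbox M) × Fin (3 + 1) => ((b.1, Sum.inl b.2) : Idx M (Fib 3)))
                (fun b : ↥(pbox M) × Fin (3 + 1) => ((b.1, Sum.inl b.2) : Idx M (Fib 3)))
            * Matrix.diagonal (fun b : ↥(pbox M) × Fin (3 + 1) => lam b.1))
      = ∑ p ∈ antidiagonal m, ∑ κ : Fin (3 + 1), ∑ y ∈ winF (Lc ^ p.1) (wid Lc p.1) w,
          compLinKer (fun _ => symLinKerAt (ctr 4 Lc) Lc) Lc p.1 (κ, y) (ρ', w) •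
           (wM2 3 L₂ j • (Matrix.diagonal (fun x : ↥(pbox M) × Fin (3 + 1) => lam x.1)
              * ((Matrix.of fun (b : Fin (3 + 1) × ↥(offs (d := 3) Lc)) (x : ↥(pbox M) × Fin (3 + 1)) => ∑' n : Site (3 + 1),
                    compLinKer (fun _ => symLinKerAt (ctr 4 Lc) Lc) Lc (p.2 + 1) (x.2, translate M (x.1 : Site (3 + 1)) n) (b.1, (Lc : ℤ) • y + (b.2 : Site (3 + 1))))ᵀ
                * Matrix.of (fun b₁ b₂ : Fin (3 + 1) × ↥(offs (d := 3) Lc) =>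
                    symHessKerAt (ctr 4 Lc) Lc κ y (b₁.1, (Lc : ℤ) • y + (b₁.2 : Site (3 + 1))) (b₂.1, (Lc : ℤ) • y + (b₂.2 : Site (3 + 1))))
                * Matrix.of fun (b : Fin (3 + 1) × ↥(offs (d := 3) Lc)) (x : ↥(pbox M) × Fin (3 + 1)) => ∑' n : Site (3 + 1),
                    compLinKer (fun _ => symLinKerAt (ctr 4 Lc) Lc) Lc (p.2 + 1) (x.2, translate M (x.1 : Site (3 + 1)) n) (b.1, (Lc : ℤ) • y + (b.2 : Site (3 + 1))))
            - ((Matrix.of fun (b : Fin (3 + 1) × ↥(offs (d := 3) Lc)) (x : ↥(pbox M) × Fin (3 + 1)) => ∑' n : Site (3 + 1),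
                    compLinKer (fun _ => symLinKerAt (ctr 4 Lc) Lc) Lc (p.2 + 1) (x.2, translate M (x.1 : Site (3 + 1)) n) (b.1, (Lc : ℤ) • y + (b.2 : Site (3 + 1))))ᵀ
                * Matrix.of (fun b₁ b₂ : Fin (3 + 1) × ↥(offs (d := 3) Lc) =>
                    symHessKerAt (ctr 4 Lc) Lc κ y (b₁.1, (Lc : ℤ) • y + (b₁.2 : Site (3 + 1))) (b₂.1, (Lc : ℤ) • y + (b₂.2 : Site (3 + 1))))
                * Matrix.of fun (b : Fin (3 + 1) × ↥(offs (d := 3) Lc)) (x : ↥(pbox M) × Fin (3 + 1)) => ∑' n : Site (3 + 1),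
                    compLinKer (fun _ => symLinKerAt (ctr 4 Lc) Lc) Lc (p.2 + 1) (x.2, translate M (x.1 : Site (3 + 1)) n) (b.1, (Lc : ℤ) • y + (b.2 : Site (3 + 1))))
              * Matrix.diagonal (fun x : ↥(pbox M) × Fin (3 + 1) => lam x.1))
          - wM2 3 L₂ j • ((Matrix.of fun (b : Fin (3 + 1) × ↥(offs (d := 3) Lc)) (x : ↥(pbox M) × Fin (3 + 1)) => ∑' n : Site (3 + 1),
                    compLinKer (fun _ => symLinKerAt (ctr 4 Lc) Lc) Lc (p.2 + 1) (x.2, translate M (x.1 : Site (3 + 1)) n) (b.1, (Lc : ℤ) • y + (b.2 : Site (3 + 1))))ᵀ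
            * (Matrix.diagonal (fun b : Fin (3 + 1) × ↥(offs (d := 3) Lc) =>
                  lam (wrapPt M (((Lc ^ (p.2 + 1) : ℕ) : ℤ) • ((Lc : ℤ) • y + (b.2 : Site (3 + 1))) + ∑ i ∈ Finset.range (p.2 + 1), ((Lc ^ i : ℕ) : ℤ) • ctr 4 Lc)))
                * Matrix.of (fun b₁ b₂ : Fin (3 + 1) × ↥(offs (d := 3) Lc) =>
                    symHessKerAt (ctr 4 Lc) Lc κ y (b₁.1, (Lc : ℤ) • y + (b₁.2 : Site (3 + 1))) (b₂.1, (Lc : ℤ) • y + (b₂.2 : Site (3 + 1))))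
              - Matrix.of (fun b₁ b₂ : Fin (3 + 1) × ↥(offs (d := 3) Lc) =>
                    symHessKerAt (ctr 4 Lc) Lc κ y (b₁.1, (Lc : ℤ) • y + (b₁.2 : Site (3 + 1))) (b₂.1, (Lc : ℤ) • y + (b₂.2 : Site (3 + 1))))
                * Matrix.diagonal (fun b : Fin (3 + 1) × ↥(offs (d := 3) Lc) =>
                  lam (wrapPt M (((Lc ^ (p.2 + 1) : ℕ) : ℤ) • ((Lc : ℤ) • y + (b.2 : Site (3 + 1))) + ∑ i ∈ Finset.range (p.2 + 1), ((Lc ^ i : ℕ) : ℤ) • ctr 4 Lc))))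
            * Matrix.of fun (b : Fin (3 + 1) × ↥(offs (d := 3) Lc)) (x : ↥(pbox M) × Fin (3 + 1)) => ∑' n : Site (3 + 1),
                    compLinKer (fun _ => symLinKerAt (ctr 4 Lc) Lc) Lc (p.2 + 1) (x.2, translate M (x.1 : Site (3 + 1)) n) (b.1, (Lc : ℤ) • y + (b.2 : Site (3 + 1))))) := by
  obtain ⟨R, hR0, hRsucc⟩ := exists_R_pins (Lc := Lc) (M := M) L₂ j
  exact (defect_eq_sum_smul_R L₂ j R hR0 hRsucc m M' hM ρ' w V hV lam).trans (sum_smul_R_eq_storeySum L₂ j R hR0 hRsucc m ρ' w lam)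


open B5Prop11Plancherel (fine)
open Summit.QuantumFields.BalabanUV.Beta.AxialDressingRooted (one_le_of_neZero)
open Summit.QuantumFields.BalabanUV.Beta.CompositeOneShotJets (tabsComp)
open Summit.QuantumFields.BalabanUV.Beta.CompositeOneShotJetData (Roots)
open Summit.QuantumFields.BalabanUV.Beta.FP.TorusCompositeObjects (towerTorus towerTorus_succ towerTorus_apply)

/-! ## §3 (v1.1) At the END wrapper's own letters (junction by kernel, as `TowerK2bDefectClosed` §4) -/

section Wrapper

variable (Mc : Fin (3 + 1) → ℕ) [∀ μ, NeZero (Mc μ)] (n : ℕ) (cM : ℕ → ℝ)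

/-- [folklore] **`defect_eq_storeySum_wrapper` — §2 AT THE END WRAPPER's OWN LETTERS, LETTER-FREE AND HYPOTHESIS-FREE**: on v8∕v9's finest torus
`T = towerTorus Lc (fine Lc Mc) (n+1)` (`T i = Lc^(n+2)·Mc i`), with the wrapper's pinned even mixed family (weights `M2Of 3 (Lc^(n+2)) … 0`, table
`(tabsComp (n+2) … (Roots.ctr Lc).hr cM).mixFF`) and composite constraint Hessian `(tabsComp (n+2) …).H` at the coarse bond `β` — `TowerK2bDefectClosed.defect_eq_sum_smul_R_wrapper`'s
LEFT side VERBATIM, i.e. v8∕v9's `Def(λ; β)` at `κ₂ := −wM2 3 (Lc^(n+2)) 0` — EQUALS the `compLinKer`-weighted storey sum of door gaps on `T` (§2's right side at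
`(M, L₂, j, m, ρ′, w) := (T, Lc^(n+2), 0, n, β.2, ↑β.1)`): §2 at `hM := towerTorus_succ ∕ towerTorus_apply`, `hV := rfl`.  No displayed letter, no hypothesis. -/
theorem defect_eq_storeySum_wrapper
    (β : ↥(pbox Mc) × Fin (3 + 1)) (lam : ↥(pbox (towerTorus Lc (fine Lc Mc) (n + 1))) → ℝ) :
    (∑ b : ↥(pbox (towerTorus Lc (fine Lc Mc) (n + 1))) × Fin (3 + 1),
        (∑ s : ↥(pbox (towerTorus Lc (fine Lc Mc) (n + 1))), tgrad (towerTorus Lc (fine Lc Mc) (n + 1)) (b.1, Sum.inl b.2) s * lam s) •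
        (perF (towerTorus Lc (fine Lc Mc) (n + 1)) (dper (towerTorus Lc (fine Lc Mc) (n + 1)) (fun X Z i₁ i₂ => ∑' m : Site (3 + 1),
          ((1 / 2 : ℝ) • (M2Of 3 (Lc ^ (n + 1 + 1)) (tabsComp (n + 1 + 1) (one_le_of_neZero Lc) (Roots.ctr Lc).hr cM).mixFF 0 b.2 (b.1 : Site (3 + 1)) β.2 (translate Mc (β.1 : Site (3 + 1)) m)
            + sgnK (trK (M2Of 3 (Lc ^ (n + 1 + 1)) (tabsComp (n + 1 + 1) (one_le_of_neZero Lc) (Roots.ctr Lc).hr cM).mixFF 0 b.2 (b.1 : Site (3 + 1)) β.2 (translate Mc (β.1 : Site (3 + 1)) m))))) X Z i₁ i₂))).submatrix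
          (fun b : ↥(pbox (towerTorus Lc (fine Lc Mc) (n + 1))) × Fin (3 + 1) => ((b.1, Sum.inl b.2) : Idx (towerTorus Lc (fine Lc Mc) (n + 1)) (Fib 3)))
          (fun b : ↥(pbox (towerTorus Lc (fine Lc Mc) (n + 1))) × Fin (3 + 1) => ((b.1, Sum.inl b.2) : Idx (towerTorus Lc (fine Lc Mc) (n + 1)) (Fib 3))))
        - (-(wM2 3 (Lc ^ (n + 1 + 1)) 0)) • (Matrix.diagonal (fun b : ↥(pbox (towerTorus Lc (fine Lc Mc) (n + 1))) × Fin (3 + 1) => lam b.1)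
            * (perF (towerTorus Lc (fine Lc Mc) (n + 1)) (dper (towerTorus Lc (fine Lc Mc) (n + 1))
                ((tabsComp (n + 1 + 1) (one_le_of_neZero Lc) (Roots.ctr Lc).hr cM).H β.2 (β.1 : Site (3 + 1))))).submatrix
                (fun b : ↥(pbox (towerTorus Lc (fine Lc Mc) (n + 1))) × Fin (3 + 1) => ((b.1, Sum.inl b.2) : Idx (towerTorus Lc (fine Lc Mc) (n + 1)) (Fib 3)))
                (fun b : ↥(pbox (towerTorus Lc (fine Lc Mc) (n + 1))) × Fin (3 + 1) => ((b.1, Sum.inl b.2) : Idx (towerTorus Lc (fine Lc Mc) (n + 1)) (Fib 3)))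
          - (perF (towerTorus Lc (fine Lc Mc) (n + 1)) (dper (towerTorus Lc (fine Lc Mc) (n + 1))
                ((tabsComp (n + 1 + 1) (one_le_of_neZero Lc) (Roots.ctr Lc).hr cM).H β.2 (β.1 : Site (3 + 1))))).submatrix
                (fun b : ↥(pbox (towerTorus Lc (fine Lc Mc) (n + 1))) × Fin (3 + 1) => ((b.1, Sum.inl b.2) : Idx (towerTorus Lc (fine Lc Mc) (n + 1)) (Fib 3)))
                (fun b : ↥(pbox (towerTorus Lc (fine Lc Mc) (n + 1))) × Fin (3 + 1) => ((b.1, Sum.inl b.2) : Idx (towerTorus Lc (fine Lc Mc) (n + 1)) (Fib 3)))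
            * Matrix.diagonal (fun b : ↥(pbox (towerTorus Lc (fine Lc Mc) (n + 1))) × Fin (3 + 1) => lam b.1))
      = ∑ p ∈ antidiagonal n, ∑ κ : Fin (3 + 1), ∑ y ∈ winF (Lc ^ p.1) (wid Lc p.1) (β.1 : Site (3 + 1)),
          compLinKer (fun _ => symLinKerAt (ctr 4 Lc) Lc) Lc p.1 (κ, y) (β.2, (β.1 : Site (3 + 1))) •
           (wM2 3 (Lc ^ (n + 1 + 1)) 0 • (Matrix.diagonal (fun x : ↥(pbox (towerTorus Lc (fine Lc Mc) (n + 1))) × Fin (3 + 1) => lam x.1)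
              * ((Matrix.of fun (b : Fin (3 + 1) × ↥(offs (d := 3) Lc)) (x : ↥(pbox (towerTorus Lc (fine Lc Mc) (n + 1))) × Fin (3 + 1)) => ∑' t : Site (3 + 1),
                    compLinKer (fun _ => symLinKerAt (ctr 4 Lc) Lc) Lc (p.2 + 1) (x.2, translate (towerTorus Lc (fine Lc Mc) (n + 1)) (x.1 : Site (3 + 1)) t) (b.1, (Lc : ℤ) • y + (b.2 : Site (3 + 1))))ᵀ
                * Matrix.of (fun b₁ b₂ : Fin (3 + 1) × ↥(offs (d := 3) Lc) =>
                    symHessKerAt (ctr 4 Lc) Lc κ y (b₁.1, (Lc : ℤ) • y + (b₁.2 : Site (3 + 1))) (b₂.1, (Lc : ℤ) • y + (b₂.2 : Site (3 + 1))))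
                * Matrix.of fun (b : Fin (3 + 1) × ↥(offs (d := 3) Lc)) (x : ↥(pbox (towerTorus Lc (fine Lc Mc) (n + 1))) × Fin (3 + 1)) => ∑' t : Site (3 + 1),
                    compLinKer (fun _ => symLinKerAt (ctr 4 Lc) Lc) Lc (p.2 + 1) (x.2, translate (towerTorus Lc (fine Lc Mc) (n + 1)) (x.1 : Site (3 + 1)) t) (b.1, (Lc : ℤ) • y + (b.2 : Site (3 + 1))))
            - ((Matrix.of fun (b : Fin (3 + 1) × ↥(offs (d := 3) Lc)) (x : ↥(pbox (towerTorus Lc (fine Lc Mc) (n + 1))) × Fin (3 + 1)) => ∑' t : Site (3 + 1),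
                    compLinKer (fun _ => symLinKerAt (ctr 4 Lc) Lc) Lc (p.2 + 1) (x.2, translate (towerTorus Lc (fine Lc Mc) (n + 1)) (x.1 : Site (3 + 1)) t) (b.1, (Lc : ℤ) • y + (b.2 : Site (3 + 1))))ᵀ
                * Matrix.of (fun b₁ b₂ : Fin (3 + 1) × ↥(offs (d := 3) Lc) =>
                    symHessKerAt (ctr 4 Lc) Lc κ y (b₁.1, (Lc : ℤ) • y + (b₁.2 : Site (3 + 1))) (b₂.1, (Lc : ℤ) • y + (b₂.2 : Site (3 + 1))))
                * Matrix.of fun (b : Fin (3 + 1) × ↥(offs (d := 3) Lc)) (x : ↥(pbox (towerTorus Lc (fine Lc Mc) (n + 1))) × Fin (3 + 1)) => ∑' t : Site (3 + 1),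
                    compLinKer (fun _ => symLinKerAt (ctr 4 Lc) Lc) Lc (p.2 + 1) (x.2, translate (towerTorus Lc (fine Lc Mc) (n + 1)) (x.1 : Site (3 + 1)) t) (b.1, (Lc : ℤ) • y + (b.2 : Site (3 + 1))))
              * Matrix.diagonal (fun x : ↥(pbox (towerTorus Lc (fine Lc Mc) (n + 1))) × Fin (3 + 1) => lam x.1))
          - wM2 3 (Lc ^ (n + 1 + 1)) 0 • ((Matrix.of fun (b : Fin (3 + 1) × ↥(offs (d := 3) Lc)) (x : ↥(pbox (towerTorus Lc (fine Lc Mc) (n + 1))) × Fin (3 + 1)) => ∑' t : Site (3 + 1),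
                    compLinKer (fun _ => symLinKerAt (ctr 4 Lc) Lc) Lc (p.2 + 1) (x.2, translate (towerTorus Lc (fine Lc Mc) (n + 1)) (x.1 : Site (3 + 1)) t) (b.1, (Lc : ℤ) • y + (b.2 : Site (3 + 1))))ᵀ
            * (Matrix.diagonal (fun b : Fin (3 + 1) × ↥(offs (d := 3) Lc) =>
                  lam (wrapPt (towerTorus Lc (fine Lc Mc) (n + 1)) (((Lc ^ (p.2 + 1) : ℕ) : ℤ) • ((Lc : ℤ) • y + (b.2 : Site (3 + 1))) + ∑ i ∈ Finset.range (p.2 + 1), ((Lc ^ i : ℕ) : ℤ) • ctr 4 Lc)))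
                * Matrix.of (fun b₁ b₂ : Fin (3 + 1) × ↥(offs (d := 3) Lc) =>
                    symHessKerAt (ctr 4 Lc) Lc κ y (b₁.1, (Lc : ℤ) • y + (b₁.2 : Site (3 + 1))) (b₂.1, (Lc : ℤ) • y + (b₂.2 : Site (3 + 1))))
              - Matrix.of (fun b₁ b₂ : Fin (3 + 1) × ↥(offs (d := 3) Lc) =>
                    symHessKerAt (ctr 4 Lc) Lc κ y (b₁.1, (Lc : ℤ) • y + (b₁.2 : Site (3 + 1))) (b₂.1, (Lc : ℤ) • y + (b₂.2 : Site (3 + 1))))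
                * Matrix.diagonal (fun b : Fin (3 + 1) × ↥(offs (d := 3) Lc) =>
                  lam (wrapPt (towerTorus Lc (fine Lc Mc) (n + 1)) (((Lc ^ (p.2 + 1) : ℕ) : ℤ) • ((Lc : ℤ) • y + (b.2 : Site (3 + 1))) + ∑ i ∈ Finset.range (p.2 + 1), ((Lc ^ i : ℕ) : ℤ) • ctr 4 Lc))))
            * Matrix.of fun (b : Fin (3 + 1) × ↥(offs (d := 3) Lc)) (x : ↥(pbox (towerTorus Lc (fine Lc Mc) (n + 1))) × Fin (3 + 1)) => ∑' t : Site (3 + 1),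
                    compLinKer (fun _ => symLinKerAt (ctr 4 Lc) Lc) Lc (p.2 + 1) (x.2, translate (towerTorus Lc (fine Lc Mc) (n + 1)) (x.1 : Site (3 + 1)) t) (b.1, (Lc : ℤ) • y + (b.2 : Site (3 + 1))))) := by
  have hM : ∀ i, towerTorus Lc (fine Lc Mc) (n + 1) i = Lc ^ (n + 1 + 1) * Mc i := fun i => by
    rw [← towerTorus_succ, towerTorus_apply]
  exact defect_eq_storeySum (Lc ^ (n + 1 + 1)) 0 n Mc hM β.2 (β.1 : Site (3 + 1)) _ rfl lam

end Wrapper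

end Summit.QuantumFields.BalabanUV.Beta.FP.TowerK2bDefectStoreySumClosed

end
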